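import Literature.Probability.LatticeModels.FKIsingInterfaceSLEAssembly
import HarnessLib

/-!
# FK-Ising interfaces and SLE_{16/3}, identification step (L): decomposition record

Topic `Literature/Probability/LatticeModels` (family `crit-ising`); theorems only.  The named
fact `Literature.Probability.LatticeModels.isSLELaw_of_isSubseqLimitLaw_fkInterfaceCurve` — (L):
every subsequential weak limit of the critical FK-Ising Dobrushin interface laws is the chordal
SLE_{16/3} law (Duminil-Copin–Smirnov, Clay Math. Proc. 15 (2012), Thm. 6.4 and Prop. 6.7;
Chelkak–Duminil-Copin–Hongler–Kemppainen–Smirnov, C. R. Math. 352 (2014), §3) — has, after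
layers 2–4 of the tree's decomposition (`FKIsingInterfaceIdentification*.lean`,
`FKIsingDrivingMartingale.lean`, `FKIsingObservableMartingale.lean`,
`FKIsingInterfaceSLEAssembly.lean`; Rohde–Schramm's Cor. 3.5, Lévy's characterisation and the
far-field extraction of the driving martingales being theorems), exactly ONE unproved
antecedent among the named facts of the tree:

* (L‴) `exists_observableMartingale_fkInterface` (`FKIsingObservableMartingale.lean`) — the
  stopped FK fermionic observable of every subsequential limit is a martingale for a version of
  the driving process (DCS 2012, Lemma 6.6, Thm. 3.15 = Smirnov 2010 Thm. 2.2, proof of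
  Prop. 6.7, p. 29; CDHKS 2014, Thm. 3 and §3 eq. (5)); its own printed inputs
  (Kemppainen–Smirnov 2017, Thm. 1.5 / Cor. 1.7 through Condition G2, and Smirnov's observable
  convergence over the slit domains) are kept as THEOREM HYPOTHESES below it
  (`exists_observableMartingale_fkInterface_of_limitData₀`, `…_of_latticeData`), by the
  bad-split ruling recorded in `FKIsingInterfaceSLEFrontier.lean`.

This file records that one-child decomposition under the uniform assembly name
`isSLELaw_of_isSubseqLimitLaw_fkInterfaceCurve_holds_of` (the landed
`isSLELaw_of_isSubseqLimitLaw_fkInterfaceCurve_of_exists_observableMartingale`).  No statement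
is introduced; the discharge `…_holds` will be this term applied to
`exists_observableMartingale_fkInterface_holds` once (L‴) lands.

## References

* H. Duminil-Copin, S. Smirnov, *Conformal invariance of lattice models*, Clay Math. Proc. 15
  (2012): Thm. 6.4, Lemma 6.6, Prop. 6.7 (proof, p. 29). [DuminilCopinSmirnov2012Clay]
* D. Chelkak, H. Duminil-Copin, C. Hongler, A. Kemppainen, S. Smirnov, C. R. Math. Acad. Sci.
  Paris 352 (2014) 157–161: Thm. 2, Thm. 3, §3. [CDHKSCRAS2014]
-/

noncomputable section

namespace Literature.Probability.LatticeModels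

/-- **Assembly: (L) from its single named-fact antecedent (L‴)** — the observable-martingale fact
`exists_observableMartingale_fkInterface` implies
`isSLELaw_of_isSubseqLimitLaw_fkInterfaceCurve` (far-field extraction of the driving
martingales, Lévy's characterisation, Rohde–Schramm's Cor. 3.5 at `κ = 16/3` and uniqueness in
law of chordal SLE all being theorems of the tree), by
`isSLELaw_of_isSubseqLimitLaw_fkInterfaceCurve_of_exists_observableMartingale`.
[cite: DuminilCopinSmirnov2012Clay, Thm. 6.4 and Prop. 6.7 (proof, p. 29)] [cite: CDHKSCRAS2014, Thm. 3 and §3] -/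
theorem isSLELaw_of_isSubseqLimitLaw_fkInterfaceCurve_holds_of :
    exists_observableMartingale_fkInterface → isSLELaw_of_isSubseqLimitLaw_fkInterfaceCurve :=
  fun h => isSLELaw_of_isSubseqLimitLaw_fkInterfaceCurve_of_exists_observableMartingale h

end Literature.Probability.LatticeModels
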